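import Literature.MathematicalPhysics.QuantumFieldTheory.Balaban1983to89.B6Prop26KLevelSkeletonV1L0
import Literature.MathematicalPhysics.QuantumFieldTheory.Balaban1983to89.B6Ineq2134KFamKLevelL0
import Literature.MathematicalPhysics.QuantumFieldTheory.Balaban1983to89.B6Cover236MultiLevelBlocksL0
import Literature.MathematicalPhysics.QuantumFieldTheory.Balaban1983to89.B6Geom246MultiLevelBoxL0
import Literature.MathematicalPhysics.QuantumFieldTheory.Balaban1983to89.B6Geom246MultiLevelTorusL0
import Literature.MathematicalPhysics.QuantumFieldTheory.Balaban1983to89.B6GlobalChartV1L0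
import Literature.MathematicalPhysics.QuantumFieldTheory.Balaban1983to89.B6MultiLevelTorusOperatorL0
import Literature.MathematicalPhysics.QuantumFieldTheory.Balaban1983to89.B6Partition118KLevelTorusCentralL0
import Literature.MathematicalPhysics.QuantumFieldTheory.Balaban1983to89.B6Partition118KLevelTorusL0
import Literature.MathematicalPhysics.QuantumFieldTheory.Balaban1983to89.B6Prop26KLevelSkeletonV2
/-!
# `Balaban1983to89.B6Prop26KLevelSkeletonV2L0` — LEVEL-0 TWIN (programme G-F3′-L0, director-ym LINE №27 / UV3-NODE §24.5; plan `lit-balaban-r03/G-F3L0-PLAN.md`) of `B6Prop26KLevelSkeletonV2`: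
the same declarations, SAME NAMES AND STATEMENTS, for nested families WITH print's region `Λ₀ = T ∖ Ω₁` ADMITTED (structures
`B6MultiLevelBoxOperatorL0.Domains` / `B6MultiLevelTorusOperatorL0.TDomains`: levels `0, …, k`, the level-`0` block a single site, `Q′₀ = id`,
finite weight `a₀` — print p.225 (2.14) «Σ_{j=0}^k … (Q′₀λ)(x) = λ(x), x ∈ Λ₀», p.229 «taking a sequence (2.1) … smallest possible domains B^j(Λ_j),
and considering the operator Δ_a defined by (2.19), (2.20) for this sequence»).  Every `D`-free object is the lineage's, consumed BY NAME; no existing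
module is touched; no fact is minted.  Unit `lit-balaban-p21` (packet S-B owner, S-C tail; p21 gen 27; port tooling by r03 gen 36 / p33 gen 88); B6 fold owner r03; referee ref-4.  THE TWIN'S DOCUMENTATION FOLLOWS
VERBATIM (its «levels 1 … k» / «Ω₁ = X» sentences describe the twin; here `j` runs from `0` and `Ω₁` may be a proper subset).

# `Balaban1983to89.B6Prop26KLevelSkeletonV2` — T. Bałaban, *Propagators and renormalization transformations for lattice gauge theories. II*,
# Commun. Math. Phys. **96** (1984) 223–250 [Balaban1984PropagatorsII], Prop. 2.6 (2.136)₁ p. 247 for the GENUINE `k`-level `G = Δ_a⁻¹` on the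
# V1 torus — THE k-LEVEL SKELETON WITH TWO SET FAMILIES (`S_□ = □⁺ ⊋ supp h_□` for (2.133), `U_□ = □̃ ⊇ supp ζ_□` for the output localisation of the
# (2.91) kernels): the repair of finding F5 of the fold owner (ROUTE V, B6-CLOSURE §5 item 14)

statement-level skeleton of published theorems with citation tags; proofs where landed; nothing here is a claim about the Yang–Mills mass gap

PDF held: `paper:balaban1984-cmp96-propagators-rt-ii` (journal page = PDF page + 222): p. 239 [PDF 17] ((2.91)–(2.93): *"ζ_□ ∈ C₀^∞(□̃), ζ_□ = 1 on a
neighbourhood of supp h_□"*), p. 247 [PDF 25] ((2.133)–(2.136)), p. 235 [PDF 13] (*"a second cube □̃ containing □ in the middle"*); read from the tree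
transcriptions in `…B6Prop26KLevelSkeletonV1`, `…B6Prop26ChainGeneric`, `…B6Prop26Gluing`.

CITATION HEADER (lean-in-tree rule) — WHAT IS REPRODUCED.  Phase-2 file of the `lit-balaban` typed skeleton (HOME `run/shared/lean/pub/lit-balaban/`), unit
`lit-balaban-r03` (B6 fold owner; r03 gen 21, literature-prover-lit-balaban-r03-g21-0), referee ref-4.  SKELETON rows **B6.Prop2.6** × **B6.Eq2.91** ×
**B6.Eq2.134** × B6.Eq2.133 × B6.Eq2.36 (cells; decls of record untouched).  FINDING F5 (owner, 2026-08-23T07:38Z): the gen-19 skeleton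
`…B6Prop26KLevelSkeletonV1L0.prop26_2136_kLevel_skeleton` uses ONE family of sets `Q^T_□ = □⁺` (p38's `QT`, radius `5S/4`) for the support of `h_□`, the
(2.133) local majorant, the overlap number AND the output localisation `hKout` of `K_{□,□′}G_{□′}`; but the diagonal kernel (2.92)
`K_{□,□} = (h_□M_□ − M_□h_□) + ζ_□(∂P∂* − P_□)h_□ + ζ_□(P_□h_□ − h_□P_□)` has outputs on `supp ζ_□ = □̃` (p38's `QbigT`, radius `7S/4`) `⊋ □⁺`, so that `hKout`
cannot be discharged for the genuine family (the V1 theorems are true, with an unsatisfiable hypothesis).  THIS FILE states and proves the skeleton with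
TWO families, importing by name and restating nothing: `B6Prop26Gluing.majorant_G0_of_2133`/`ineq2135_of_2134_291` (pv09), `B6Prop26ChainGeneric.prop26_chain_2136With`,
`B6Prop26.fixedPoint_of_291`, `B6Ineq2134KFamKLevel.outLoc_kFam` (p38), and everything `…B6Prop26KLevelSkeletonV1` imports (`eq291`, `lemma21_torus`,
`deltaAE_split`, `GE_comp_deltaAE`, p38's `hT`/`zetaT`/`QT`/`QbigT`).

## WHAT THIS FILE CERTIFIES (kernel-checked, 0 sorry, standard axioms; no `def … : Prop`, no new named fact; ONE definition WITH BODY: `SbigT` (the set `□̃` of sites, companion of V1's `ST`))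

* §1 **`prop26_2136_of_2133_2134With₂`** — the generic gluing (pv09's `prop26_2136_of_2133_2134With`) with TWO set families: `S_□` carries `supp h_□` and the
  (2.133) local majorant of `G_□` (the `G₀ = Σ h_□G_□h_□` term), `U_□ ⊇ S_□` carries the output localisation of `K_{□,□′}G_{□′}` (the `R`-term (2.135)); one
  overlap number `N` of the `U_□` serves both (`card_filter_mono`).
* §2 the torus data: `SbigT`/`mem_SbigT` (`□̃` as a set of sites), `ST_subset_SbigT`, `hNov_SbigT_of_QbigT` (a count of the finite sets `QbigT □` — p21's
  shape — bounds the overlap of the `SbigT □`), `blkV1_mem_SbigT_of_zB_ne_zero` (`supp ζ_□ ⊂ □̃` blockwise — `zetaT` is the indicator of `QbigT`),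
  `blkV1_mem_SbigT_of_hB_ne_zero` (`supp h_□ ⊂ □⁺ ⊂ □̃`), **`outLoc_kFam_big`** (hKout over `□̃` from ONE
  honest input: the output localisation `OutLoc (M_□·h_□) □̃` of the member's local operator — p38's `outLoc_kFam`), `kFam_smul` (the (2.91) family is
  homogeneous of degree one in `(∂P∂*, M_□, P_□)`: `kFam (s•Dg) h ζ (s•M) (s•P) = s•kFam Dg h ζ M P` — the unit bookkeeping of the assembly).
* §3 **`prop26_2136_kLevel_skeleton₂`** — PROPOSITION 2.6 (2.136)₁ FOR THE GENUINE k-LEVEL `G = GE (domT hN D hk)`: the statement of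
  `prop26_2136_kLevel_skeleton` with (h2133) on `Q^T_□ = □⁺` UNCHANGED, the overlap number `Nov` now of the `□̃ = QbigT`, and (hKout) over `□̃`; and
  **`prop26_2136_kLevel_skeleton₂'`** — the same with (hKout) DISCHARGED from `hMout : OutLoc (M_□·h_□) □̃` per cube.

## HONEST SCOPE / DIVERGENCES

(1) As `…B6Prop26KLevelSkeletonV1` (member operators displayed; `L ≥ 2`, `M_h ≥ 2`, `R ≥ 2L`, `P′_μ ≥ 5`; `k ≤ m + K`; lattice factor `c′` free; entries
(2.136)₂₋₄ untouched).  (2) The two radii `5S/4` (□⁺ ⊃ supp h_□) and `7S/4` (□̃ = supp ζ_□) are p38's (`B6Cover236MultiLevelBlocksL0.Q`,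
`B6Partition118KLevelFineLipL0.Qbig`); print's □̃ «of the size 4M».  (3) The overlap number of the `□̃` is a displayed parameter here (p21's count
`card_filter_mem_QT_le` is for `□⁺`; the `□̃` count is requested, finding F5 (i)).  (4) The V1 skeleton and its corollaries in `…B6CubeWindowV1`
(`prop26_2136_kLevel_cubes`, `_band`, `_band_nov`) stay in the tree as true statements whose `hKout` is not dischargeable for the genuine family; their
(h2133)/(hagree)/(hinvl) discharges are reused verbatim by the successors built on THIS file.  Value = typed skeleton repair; NOT summit progress.
-/

open scoped BigOperators
open Finset

namespace Literature.MathematicalPhysics.QuantumFieldTheory.Balaban1983to89.B6Prop26KLevelSkeletonV2L0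

open B4Reflection242 (boxDom)
open B6MultiLevelBoxOperator (N0)
open B6MultiLevelTorusOperatorL0 (TDomains)
open B6Cover236MultiLevelBlocksL0 (cubes)
open B6Geom246MultiLevelBoxL0 (bset blkOf)
open B6Geom246MultiLevelTorusL0 (geomT lemma21_torus triangle_refl_nonneg_T)
open B6RandomWalk (HasMajorant hasMajorant_mono delta3 Triangle254)
open B6Prop26Gluing (mulOp mulOp_apply LocalMajorant OutLoc majorant_G0_of_2133 ineq2135_of_2134_291)
open B6Prop26 (fixedPoint_of_291)
open B6Lemma21Repaired (Ineq261With Ineq263With)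
open B6Ineq261LevelGap (K261 K261_nonneg)
open B6Prop26ChainGeneric (prop26_chain_2136With)
open B6Eq291Generator (kFam kDiag kOff gZero rOp eq291)
open B6Ineq2133TwoScaleV1 (onFun)
open B6GlobalChartV1 (PV toBox)
open B6GlobalChartV1L0 (domT blkV1)
open B6AgreeLapV1Chart (deltaAE_split onFun_comp onFun_id)
open B6SectAOperatorsV1 (dE dsE dcE dcsE QE aE QsE RE BondIdx)
open B6SectAVectorModelV1 (deltaAE GE GE_comp_deltaAE)
open B6Partition118KLevelTorusL0 (hT sum_hT_sq abs_hT_le_one)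
open B6Partition118KLevelTorusCentral (one_le_of_four_le)
open B6Partition118KLevelTorusCentralL0 (QT QbigT zetaT QT_subset_QbigT)
open B6Prop26KLevelSkeletonV1 (onFun_GE_mul_deltaAE)
open B6Prop26KLevelSkeletonV1L0 (hB zB ST mem_ST pref pref_nonneg sum_hB_sq abs_hB_le_one blkV1_mem_QT_of_hB_ne_zero mulOp_zB_mul_hB mulOp_hB_mul_zB sum_mulOp_hB_sq)
open B6Ineq2134KFamKLevel (outLoc_kFam)
open Literature.MathematicalPhysics.QuantumFieldTheory.Balaban1983to89.B6Prop26KLevelSkeletonV2 (card_filter_mono prop26_2136_of_2133_2134With₂ kFam_smul)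

noncomputable section

/-! ## §1  The gluing with two set families -/

section Gluing

variable {g : B6.Geometry} {X : Type}

end Gluing

/-! ## §2  The torus data for the two families `□⁺ = QT`, `□̃ = QbigT` -/

section Data

variable {d ℓ : ℕ} {hd : 1 ≤ d + 1} {hL : Odd (ℓ + 1) ∧ 1 < ℓ + 1} {m K : ℕ} {Mh k R : ℕ} {P' : Fin (d + 1) → ℕ}
variable (hN : ∀ μ, N0 ℓ Mh k P' μ = (PV d ℓ m K hd hL).sitesPerDir 0) (D : TDomains d ℓ Mh k P' R)

/-- **THE CUT-OFF SET `□̃` AS A SET OF SITES OF `geomT D`** (p38's `QbigT`: the blocks within `7S_j/4` of the cube's centre, through the block map) — the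
carrier of `supp ζ_□` and of the outputs of the (2.91) kernels; companion of `…B6Prop26KLevelSkeletonV1L0.ST` (`□⁺`).  (A definition, so that — as for
`ST` — membership is decided classically wherever an overlap number is counted.) [cite: Balaban1984PropagatorsII, p.239 («ζ_□ ∈ C₀^∞(□̃)»), p.235, dictionary] -/
def SbigT (hMh1 : 1 ≤ Mh) (hP4 : ∀ μ, 4 ≤ P' μ) (c : ↥(cubes D.toDomains)) : Set (geomT D).Site := {a | a ∈ QbigT D hMh1 hP4 c}

/-- membership in `SbigT`. [cite: Balaban1984PropagatorsII, p.239, dictionary] -/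
@[simp] theorem mem_SbigT (hMh1 : 1 ≤ Mh) (hP4 : ∀ μ, 4 ≤ P' μ) (c : ↥(cubes D.toDomains)) (a : (geomT D).Site) :
    a ∈ SbigT D hMh1 hP4 c ↔ a ∈ QbigT D hMh1 hP4 c := Iff.rfl

/-- `□⁺ ⊆ □̃` as sets of sites. [cite: Balaban1984PropagatorsII, p.235, p.239, bookkeeping] -/
theorem ST_subset_SbigT (hMh1 : 1 ≤ Mh) (hP4 : ∀ μ, 4 ≤ P' μ) (c : ↥(cubes D.toDomains)) :
    ST D hMh1 hP4 c ⊆ SbigT D hMh1 hP4 c := fun a ha => QT_subset_QbigT hMh1 hP4 c ((mem_ST D hMh1 hP4 c a).1 ha)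

open Classical in
/-- an overlap bound of the finite sets `QbigT □` is an overlap bound of the sets `SbigT □` (the shape of `prop26_2136_kLevel_skeleton₂`'s `hNov`).
[cite: Balaban1984PropagatorsII, p.235, bookkeeping] -/
theorem hNov_SbigT_of_QbigT (hMh1 : 1 ≤ Mh) (hP4 : ∀ μ, 4 ≤ P' μ) {Nov : ℕ}
    (hNov : ∀ a : (geomT D).Site, (Finset.univ.filter fun c : ↥(cubes D.toDomains) => a ∈ QbigT D hMh1 hP4 c).card ≤ Nov) :
    ∀ a : (geomT D).Site, (Finset.univ.filter fun c : ↥(cubes D.toDomains) => a ∈ SbigT D hMh1 hP4 c).card ≤ Nov := by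
  intro a
  have e : (Finset.univ.filter fun c : ↥(cubes D.toDomains) => a ∈ SbigT D hMh1 hP4 c) =
      (Finset.univ.filter fun c : ↥(cubes D.toDomains) => a ∈ QbigT D hMh1 hP4 c) := by
    ext c
    simp only [Finset.mem_filter, mem_SbigT]
  rw [e]
  exact hNov a

/-- **`supp ζ_□ ⊂ □̃`** blockwise: `ζ_□(b) ≠ 0 ⟹ y(b₋) ∈ QbigT □` (`zetaT` is the indicator of the blocks of `□̃`).
[cite: Balaban1984PropagatorsII, (2.91) p.239 («ζ_□ ∈ C₀^∞(□̃)»)] -/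
theorem blkV1_mem_SbigT_of_zB_ne_zero (hMh1 : 1 ≤ Mh) (hP4 : ∀ μ, 4 ≤ P' μ) (c : ↥(cubes D.toDomains)) {b : PBond (PV d ℓ m K hd hL) 0}
    (h : zB hN D hMh1 hP4 c b ≠ 0) : blkV1 hN D b ∈ SbigT D hMh1 hP4 c := by
  have key : blkOf D.toDomains (toBox hN b.src) ∈ QbigT D hMh1 hP4 c := by
    by_contra hq
    exact h (by unfold zB zetaT; rw [if_neg hq])
  exact key

/-- **`supp h_□ ⊂ □̃`** blockwise (`□⁺ ⊆ □̃`). [cite: Balaban1984PropagatorsII, (2.36) p.229, p.239] -/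
theorem blkV1_mem_SbigT_of_hB_ne_zero (hMh : 2 ≤ Mh) (hR : 2 * (ℓ + 1) ≤ R) {hMh1 : 1 ≤ Mh} (hP4 : ∀ μ, 4 ≤ P' μ) (c : ↥(cubes D.toDomains))
    {b : PBond (PV d ℓ m K hd hL) 0} (h : hB hN D c b ≠ 0) : blkV1 hN D b ∈ SbigT D hMh1 hP4 c :=
  ST_subset_SbigT D hMh1 hP4 c (blkV1_mem_QT_of_hB_ne_zero hN D hMh hR hP4 c h)

/-- **hKout OVER `□̃` FROM ONE INPUT**: if the member's local operator applied after `h_□` has outputs in `□̃` (`OutLoc (M_□·h_□) □̃` — bond range one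
around `supp h_□ ⊂ □⁺`), then every `K_{□,□′}G_{□′}` of the genuine (2.91) family is output-localised to `□̃` (p38's `outLoc_kFam` with `supp h_□, supp ζ_□ ⊂ □̃`).
[cite: Balaban1984PropagatorsII, (2.91)–(2.93) p.239] -/
theorem outLoc_kFam_big (hMh : 2 ≤ Mh) (hR : 2 * (ℓ + 1) ≤ R) (hMh1 : 1 ≤ Mh) (hP4 : ∀ μ, 4 ≤ P' μ)
    (Dg : Module.End ℝ (PBond (PV d ℓ m K hd hL) 0 → ℝ)) (Gl Ml Pl : ↥(B6Cover236MultiLevelBlocksL0.cubes D.toDomains) → Module.End ℝ (PBond (PV d ℓ m K hd hL) 0 → ℝ))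
    (hMout : ∀ c, OutLoc (g := geomT D) (blkV1 hN D) (Ml c * mulOp (hB hN D c)) (SbigT D hMh1 hP4 c)) :
    ∀ c c', OutLoc (g := geomT D) (blkV1 hN D)
      (kFam Dg (fun c => mulOp (hB hN D c)) (fun c => mulOp (zB hN D hMh1 hP4 c)) Ml Pl c c' * Gl c') (SbigT D hMh1 hP4 c) := by
  intro c c'
  exact outLoc_kFam (g := geomT D) (blkV1 hN D) Finset.univ (Dg := Dg) (G := Gl) (Ml := Ml) (Pl := Pl) (h := hB hN D) (ζ := zB hN D hMh1 hP4)
    (T := fun c => SbigT D hMh1 hP4 c)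
    (fun c _ x hx => blkV1_mem_SbigT_of_hB_ne_zero hN D hMh hR hP4 c hx)
    (fun c _ x hx => blkV1_mem_SbigT_of_zB_ne_zero hN D hMh1 hP4 c hx) (fun c _ => hMout c) c (Finset.mem_univ _) c' (Finset.mem_univ _)

end Data

/-! ## §3  Proposition 2.6 (2.136)₁ at k levels — the two-family skeleton -/

section Skeleton

variable {d ℓ : ℕ} {hd : 1 ≤ d + 1} {hL : Odd (ℓ + 1) ∧ 1 < ℓ + 1} {m K : ℕ} {Mh k R : ℕ} {P' : Fin (d + 1) → ℕ}

open Classical in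
/-- **PROPOSITION 2.6, ENTRY (2.136)₁, FOR THE GENUINE k-LEVEL `G = Δ_a⁻¹` ON THE V1 TORUS — THE TWO-FAMILY SKELETON** (repair of
`prop26_2136_kLevel_skeleton`, finding F5): hypotheses and conclusion as there, EXCEPT: the overlap number `Nov` is that of the sets `□̃ = QbigT □` and the
output localisation (hKout) of `K_{□,□′}G_{□′}` is over `□̃`; (h2133) stays the local majorant on `□⁺ = Q^T_□`, `supp h_□ ⊂ □⁺`.  Conclusion:
`HasMajorant (geomT D) (blkV1 hN D) G ((Nov·A)·c₁·(1 − Nov²θ₀c₁)⁻¹·(L^{j(y)}/c′)²·e^{−δ₃d_T})`, `c₁ = K261 N₀ (d+1) L 1 (αδ/(d+1))`, `δ₃ = delta3 α (2δ/(d+1))`.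
[cite: Balaban1984PropagatorsII, Prop. 2.6 (2.136) p.247, (2.133)–(2.135) p.247, (2.91)–(2.93) p.239, (2.36) p.229, Lemma 2.1 p.234] -/
theorem prop26_2136_kLevel_skeleton₂ (hN : ∀ μ, N0 ℓ Mh k P' μ = (PV d ℓ m K hd hL).sitesPerDir 0) (D : TDomains d ℓ Mh k P' R) (hk : k ≤ m + K)
    (hMh : 2 ≤ Mh) (hR : 2 * (ℓ + 1) ≤ R) (hP5 : ∀ μ, 5 ≤ P' μ)
    {δ A : ℝ} (hδ : 0 < δ) (hA : 0 ≤ A)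
    (α : ℝ) (hα0 : 0 ≤ α) (hα1 : α ≤ 1) (N₀ : ℕ) (hN₀ : 0 < N₀) (hRM : N₀ + 1 ≤ R * ((ℓ + 1) * Mh))
    (hθ : Real.exp (-(α * (δ / (d + 1)))) * ((ℓ : ℝ) + 1) ^ ((2 * (d + 1 : ℕ) : ℝ) / N₀) < 1)
    {cf : ℝ} (hcf : cf ≠ 0) {w : BondIdx (domT hN D hk) → ℝ} (hw : ∀ i, 0 < w i)
    -- overlap of the OUTPUT sets `□̃`
    (Nov : ℕ) (hNov : ∀ a : (geomT D).Site, (Finset.univ.filter fun c : ↥(cubes D.toDomains) =>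
      a ∈ SbigT D (le_trans one_le_two hMh) (fun μ => le_trans (by norm_num) (hP5 μ)) c).card ≤ Nov)
    (Gl Ml Pl : ↥(cubes D.toDomains) → Module.End ℝ (PBond (PV d ℓ m K hd hL) 0 → ℝ))
    (h2133 : ∀ c, LocalMajorant (g := geomT D) (blkV1 hN D) (Gl c)
      (ST D (le_trans one_le_two hMh) (fun μ => le_trans (by norm_num) (hP5 μ)) c)
      (fun a b => A * pref cf a * Real.exp (-((2 * (δ / (d + 1))) / 2 * (geomT D).dist a b))))
    (hagree : ∀ c, onFun (dcsE (P := PV d ℓ m K hd hL) cf ∘ₗ dcE cf + dE cf ∘ₗ dsE cf +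
        QsE (domT hN D hk) ∘ₗ aE (domT hN D hk) w ∘ₗ QE (domT hN D hk)) * mulOp (hB hN D c) = Ml c * mulOp (hB hN D c))
    (hinvl : ∀ c, (Ml c - Pl c) * Gl c * mulOp (hB hN D c) = mulOp (hB hN D c))
    (θ₀ : ℝ) (hθ₀ : 0 ≤ θ₀)
    (h2134 : ∀ c c', HasMajorant (g := geomT D) (blkV1 hN D)
      ((kFam (onFun (dE (P := PV d ℓ m K hd hL) cf ∘ₗ (LinearMap.id - RE (domT hN D hk) cf) ∘ₗ dsE cf))
          (fun c => mulOp (hB hN D c)) (fun c => mulOp (zB hN D (le_trans one_le_two hMh) (fun μ => le_trans (by norm_num) (hP5 μ)) c))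
          Ml Pl c c' * Gl c') * mulOp (hB hN D c'))
      (fun a b => θ₀ * Real.exp (-((2 * (δ / (d + 1))) / 2 * (geomT D).dist a b))))
    (hKout : ∀ c c', OutLoc (g := geomT D) (blkV1 hN D)
      (kFam (onFun (dE (P := PV d ℓ m K hd hL) cf ∘ₗ (LinearMap.id - RE (domT hN D hk) cf) ∘ₗ dsE cf))
          (fun c => mulOp (hB hN D c)) (fun c => mulOp (zB hN D (le_trans one_le_two hMh) (fun μ => le_trans (by norm_num) (hP5 μ)) c))
          Ml Pl c c' * Gl c')
      (SbigT D (le_trans one_le_two hMh) (fun μ => le_trans (by norm_num) (hP5 μ)) c))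
    (hsmall : (Nov : ℝ) ^ 2 * θ₀ * K261 N₀ (d + 1) ((ℓ : ℝ) + 1) 1 (α * (δ / (d + 1))) < 1) :
    HasMajorant (g := geomT D) (blkV1 hN D) (onFun (GE (domT hN D hk) hcf hw))
      (fun a b => (Nov * A) * K261 N₀ (d + 1) ((ℓ : ℝ) + 1) 1 (α * (δ / (d + 1))) *
        (1 - (Nov : ℝ) ^ 2 * θ₀ * K261 N₀ (d + 1) ((ℓ : ℝ) + 1) 1 (α * (δ / (d + 1))))⁻¹ * pref cf a *
        Real.exp (-(delta3 α (2 * (δ / (d + 1))) * (geomT D).dist a b))) := by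
  classical
  have hMh1 : 1 ≤ Mh := le_trans one_le_two hMh
  have hP4 : ∀ μ, 4 ≤ P' μ := fun μ => le_trans (by norm_num) (hP5 μ)
  have hP : ∀ μ, 1 ≤ P' μ := one_le_of_four_le hP4
  have hδ0 : (0 : ℝ) ≤ δ / (d + 1) := by positivity
  obtain ⟨_, h261, _, h263⟩ := lemma21_torus D hMh1 hP hN₀ hRM hδ0 hα0 hα1 hθ
  obtain ⟨htri, hrefl, hdnn⟩ := triangle_refl_nonneg_T D hMh1 hP
  have hc : 0 ≤ K261 N₀ (d + 1) ((ℓ : ℝ) + 1) 1 (α * (δ / (d + 1))) := K261_nonneg (by positivity) zero_le_one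
  have hδ2 : (0 : ℝ) ≤ 2 * (δ / (d + 1)) := by positivity
  have hhalf : 2 * (δ / (d + 1)) / 2 = δ / (d + 1) := by ring
  have hle : ∀ c ∈ (Finset.univ : Finset ↥(cubes D.toDomains)), ∀ b, |hB hN D c b| ≤ 1 := fun c _ b => abs_hB_le_one hN D hMh1 hP c b
  have hsupp : ∀ c ∈ (Finset.univ : Finset ↥(cubes D.toDomains)), ∀ b, hB hN D c b ≠ 0 →
      blkV1 hN D b ∈ ST D hMh1 hP4 c := fun c _ b hb => blkV1_mem_QT_of_hB_ne_zero hN D hMh hR hP4 c hb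
  have h291 : onFun (deltaAE (domT hN D hk) cf w) * gZero Finset.univ (fun c => mulOp (hB hN D c)) Gl =
      1 - rOp Finset.univ (onFun (dE (P := PV d ℓ m K hd hL) cf ∘ₗ (LinearMap.id - RE (domT hN D hk) cf) ∘ₗ dsE cf))
        (fun c => mulOp (hB hN D c)) (fun c => mulOp (zB hN D hMh1 hP4 c)) Gl Ml Pl := by
    rw [deltaAE_split]
    exact eq291 Finset.univ _ _ (fun c => mulOp (hB hN D c)) (fun c => mulOp (zB hN D hMh1 hP4 c)) Gl Ml Pl
      (sum_mulOp_hB_sq hN D hMh1 hP) (fun c _ => hagree c) (fun c _ => hinvl c)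
      (fun c _ => mulOp_zB_mul_hB hN D hMh hR hP4 c) (fun c _ => mulOp_hB_mul_zB hN D hMh hR hP4 c)
  have hinv := onFun_GE_mul_deltaAE (domT hN D hk) hcf hw
  have hmain := prop26_2136_of_2133_2134With₂ (g := geomT D) (blkV1 hN D) (K261 N₀ (d + 1) ((ℓ : ℝ) + 1) 1 (α * (δ / (d + 1))))
    (2 * (δ / (d + 1))) α θ₀ A (pref cf) hc hA (pref_nonneg cf) hθ₀ hα1 hδ2 htri hrefl hdnn (by rw [hhalf]; exact h261) (by rw [hhalf]; exact h263)
    Finset.univ (fun c => ST D hMh1 hP4 c) (fun c => SbigT D hMh1 hP4 c) (fun c _ => ST_subset_SbigT D hMh1 hP4 c)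
    Nov hNov hsmall (hB hN D) hsupp hle Gl (fun c _ => h2133 c)
    (fun c c' => kFam (onFun (dE (P := PV d ℓ m K hd hL) cf ∘ₗ (LinearMap.id - RE (domT hN D hk) cf) ∘ₗ dsE cf))
      (fun c => mulOp (hB hN D c)) (fun c => mulOp (zB hN D hMh1 hP4 c)) Ml Pl c c' * Gl c')
    (fun c _ c' _ => h2134 c c') (fun c _ c' _ => hKout c c') (G0 := gZero Finset.univ (fun c => mulOp (hB hN D c)) Gl)
    (R := rOp Finset.univ (onFun (dE (P := PV d ℓ m K hd hL) cf ∘ₗ (LinearMap.id - RE (domT hN D hk) cf) ∘ₗ dsE cf))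
      (fun c => mulOp (hB hN D c)) (fun c => mulOp (zB hN D hMh1 hP4 c)) Gl Ml Pl) rfl rfl hinv h291
  exact hmain

open Classical in
/-- **THE TWO-FAMILY SKELETON WITH (hKout) DISCHARGED** from the member-side output localisation `hMout : OutLoc (M_□·h_□) □̃` (`outLoc_kFam_big`).
[cite: Balaban1984PropagatorsII, Prop. 2.6 (2.136) p.247, (2.91)–(2.93) p.239, (2.133)–(2.135) p.247] -/
theorem prop26_2136_kLevel_skeleton₂' (hN : ∀ μ, N0 ℓ Mh k P' μ = (PV d ℓ m K hd hL).sitesPerDir 0) (D : TDomains d ℓ Mh k P' R) (hk : k ≤ m + K)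
    (hMh : 2 ≤ Mh) (hR : 2 * (ℓ + 1) ≤ R) (hP5 : ∀ μ, 5 ≤ P' μ)
    {δ A : ℝ} (hδ : 0 < δ) (hA : 0 ≤ A)
    (α : ℝ) (hα0 : 0 ≤ α) (hα1 : α ≤ 1) (N₀ : ℕ) (hN₀ : 0 < N₀) (hRM : N₀ + 1 ≤ R * ((ℓ + 1) * Mh))
    (hθ : Real.exp (-(α * (δ / (d + 1)))) * ((ℓ : ℝ) + 1) ^ ((2 * (d + 1 : ℕ) : ℝ) / N₀) < 1)
    {cf : ℝ} (hcf : cf ≠ 0) {w : BondIdx (domT hN D hk) → ℝ} (hw : ∀ i, 0 < w i)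
    (Nov : ℕ) (hNov : ∀ a : (geomT D).Site, (Finset.univ.filter fun c : ↥(cubes D.toDomains) =>
      a ∈ SbigT D (le_trans one_le_two hMh) (fun μ => le_trans (by norm_num) (hP5 μ)) c).card ≤ Nov)
    (Gl Ml Pl : ↥(cubes D.toDomains) → Module.End ℝ (PBond (PV d ℓ m K hd hL) 0 → ℝ))
    (h2133 : ∀ c, LocalMajorant (g := geomT D) (blkV1 hN D) (Gl c)
      (ST D (le_trans one_le_two hMh) (fun μ => le_trans (by norm_num) (hP5 μ)) c)
      (fun a b => A * pref cf a * Real.exp (-((2 * (δ / (d + 1))) / 2 * (geomT D).dist a b))))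
    (hagree : ∀ c, onFun (dcsE (P := PV d ℓ m K hd hL) cf ∘ₗ dcE cf + dE cf ∘ₗ dsE cf +
        QsE (domT hN D hk) ∘ₗ aE (domT hN D hk) w ∘ₗ QE (domT hN D hk)) * mulOp (hB hN D c) = Ml c * mulOp (hB hN D c))
    (hinvl : ∀ c, (Ml c - Pl c) * Gl c * mulOp (hB hN D c) = mulOp (hB hN D c))
    (hMout : ∀ c, OutLoc (g := geomT D) (blkV1 hN D) (Ml c * mulOp (hB hN D c))
      (SbigT D (le_trans one_le_two hMh) (fun μ => le_trans (by norm_num) (hP5 μ)) c))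
    (θ₀ : ℝ) (hθ₀ : 0 ≤ θ₀)
    (h2134 : ∀ c c', HasMajorant (g := geomT D) (blkV1 hN D)
      ((kFam (onFun (dE (P := PV d ℓ m K hd hL) cf ∘ₗ (LinearMap.id - RE (domT hN D hk) cf) ∘ₗ dsE cf))
          (fun c => mulOp (hB hN D c)) (fun c => mulOp (zB hN D (le_trans one_le_two hMh) (fun μ => le_trans (by norm_num) (hP5 μ)) c))
          Ml Pl c c' * Gl c') * mulOp (hB hN D c'))
      (fun a b => θ₀ * Real.exp (-((2 * (δ / (d + 1))) / 2 * (geomT D).dist a b))))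
    (hsmall : (Nov : ℝ) ^ 2 * θ₀ * K261 N₀ (d + 1) ((ℓ : ℝ) + 1) 1 (α * (δ / (d + 1))) < 1) :
    HasMajorant (g := geomT D) (blkV1 hN D) (onFun (GE (domT hN D hk) hcf hw))
      (fun a b => (Nov * A) * K261 N₀ (d + 1) ((ℓ : ℝ) + 1) 1 (α * (δ / (d + 1))) *
        (1 - (Nov : ℝ) ^ 2 * θ₀ * K261 N₀ (d + 1) ((ℓ : ℝ) + 1) 1 (α * (δ / (d + 1))))⁻¹ * pref cf a *
        Real.exp (-(delta3 α (2 * (δ / (d + 1))) * (geomT D).dist a b))) :=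
  prop26_2136_kLevel_skeleton₂ hN D hk hMh hR hP5 hδ hA α hα0 hα1 N₀ hN₀ hRM hθ hcf hw Nov hNov Gl Ml Pl h2133 hagree hinvl θ₀ hθ₀ h2134
    (outLoc_kFam_big hN D hMh hR (le_trans one_le_two hMh) (fun μ => le_trans (by norm_num) (hP5 μ)) _ Gl Ml Pl hMout) hsmall

end Skeleton

end

end Literature.MathematicalPhysics.QuantumFieldTheory.Balaban1983to89.B6Prop26KLevelSkeletonV2L0
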